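import Mathlib

/-!
# SoloBlind — the genus floor on the T₈ face and the numerical skeleton of Corollary ΛF-K3

Solo seat `solo-HodgeConjecture-blind`, session s36 (HOME `work/s36/genus-floor-and-monodromy.md`,
`work/s35/wedge-forms.md`).

Context (paper statements, not formalised here).  THEOREM ΛF (s35): for a reduced irreducible plane
curve `Γ` of degree `d ≥ 4` with normalisation `C` of genus `g`, and any subgroup `H ≤ S_d`, every smooth
model `Ỹ` of the intermediate quotient `S_G / H` of the `S_d`-Galois closure of the line-section cover of
`Γ` satisfies `q(Ỹ) ≥ (r₁ - 1) g` and `p_g(Ỹ) ≥ b(H)·C(g+1,2) + a(H)·C(g,2)`, where `r₁, r₂, r₂⁺` are the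
numbers of `H`-orbits on letters, on unordered pairs, and on unflipped unordered pairs, `a = r₂ - r₁`,
`b = r₂⁺ - r₁ + 1`.  If `Ỹ` is K3 (`p_g = 1`, `q = 0`) then `r₁ = 1` and `b·C(g+1,2) + a·C(g,2) ≤ 1`.
LEMMA GF (s36, from Lemma U of s25): on the `T₈` face a seventh-form carrier `Z ⊂ X × C × C` forces
`J(C) ⊇ A₊ × A₋` up to isogeny (two non-isogenous simple abelian eightfolds), so `g(C) ≥ 16`; in the
asymmetric form each curve has genus `≥ 8`.  Kernel-checked here: the elementary arithmetic that turns
these into "`H` is 2-transitive" (`a = b = 0`) for every `g ≥ 3`, hence on the face, and the shape of the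
off-face genus-2 residual (`b = 0`, `a ≤ 1`).
-/

namespace Summit.HodgeConjecture.HodgeConjecture.Theorems.SoloBlindCarrierGenus

/-- `C(g,2) ≥ 3` for `g ≥ 3`. -/
theorem three_le_choose_two (g : ℕ) (hg : 3 ≤ g) : 3 ≤ g.choose 2 := by
  have h : Nat.choose 3 2 ≤ Nat.choose g 2 := Nat.choose_mono 2 hg
  have h3 : Nat.choose 3 2 = 3 := by decide
  omega

/-- `C(g+1,2) ≥ 6` for `g ≥ 3`. -/
theorem six_le_choose_succ_two (g : ℕ) (hg : 3 ≤ g) : 6 ≤ (g + 1).choose 2 := by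
  have h : Nat.choose 4 2 ≤ Nat.choose (g + 1) 2 := Nat.choose_mono 2 (by omega)
  have h4 : Nat.choose 4 2 = 6 := by decide
  omega

/-- Numerical skeleton of Corollary ΛF-K3: if `g ≥ 3` and `b·C(g+1,2) + a·C(g,2) ≤ 1` (the K3 bound
`p_g ≤ 1` applied to the ΛF lower bound) then `a = b = 0`, i.e. `r₂ = r₁ = 1` and the unique pair orbit
is flipped: `H` is 2-transitive. -/
theorem lambdaF_K3_numerics (g a b : ℕ) (hg : 3 ≤ g)
    (h : b * (g + 1).choose 2 + a * g.choose 2 ≤ 1) : a = 0 ∧ b = 0 := by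
  have hc := three_le_choose_two g hg
  have hc' := six_le_choose_succ_two g hg
  refine ⟨?_, ?_⟩
  · by_contra ha
    have ha1 : 1 ≤ a := Nat.one_le_iff_ne_zero.mpr ha
    have h1 : g.choose 2 ≤ a * g.choose 2 := Nat.le_mul_of_pos_left _ ha1
    have h2 : 0 ≤ b * (g + 1).choose 2 := Nat.zero_le _
    omega
  · by_contra hb
    have hb1 : 1 ≤ b := Nat.one_le_iff_ne_zero.mpr hb
    have h1 : (g + 1).choose 2 ≤ b * (g + 1).choose 2 := Nat.le_mul_of_pos_left _ hb1
    have h2 : 0 ≤ a * g.choose 2 := Nat.zero_le _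
    omega

/-- The off-face genus-2 residual of Corollary ΛF-K3: at `g = 2` (`C(3,2) = 3`, `C(2,2) = 1`) the K3
bound only gives `b = 0` and `a ≤ 1` (rank `≤ 3` with self-paired orbitals). -/
theorem lambdaF_K3_genus_two (a b : ℕ) (h : b * 3 + a * 1 ≤ 1) : b = 0 ∧ a ≤ 1 := by
  omega

/-- Lemma GF, numerology: in the symmetric seventh form the Jacobian of the carrier curve contains two
non-isogenous simple abelian eightfolds, so `g ≥ 8 + 8 = 16 ≥ 3`; the genus-2 corner is empty on the face. -/
theorem face_genus_floor (g d₁ d₂ : ℕ) (h₁ : 8 ≤ d₁) (h₂ : 8 ≤ d₂) (h : d₁ + d₂ ≤ g) :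
    16 ≤ g ∧ 3 ≤ g ∧ g ≠ 2 := by
  omega

/-- Corollary ΛF-K3 on the T₈ face: with the genus floor `g ≥ 16` the K3 bound forces `a = b = 0`
(`H` 2-transitive) with no genus-2 exception. -/
theorem lambdaF_K3_on_face (g a b : ℕ) (hg : 16 ≤ g)
    (h : b * (g + 1).choose 2 + a * g.choose 2 ≤ 1) : a = 0 ∧ b = 0 :=
  lambdaF_K3_numerics g a b (by omega) h

end Summit.HodgeConjecture.HodgeConjecture.Theorems.SoloBlindCarrierGenus
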